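import Mathlib.NumberTheory.LSeries.Dirichlet
import Mathlib.Analysis.Complex.Convex
import Literature.NumberTheory.EllipticCurves.ArtinFormalismAbelianEulerProofs
import Literature.NumberTheory.EllipticCurves.AnalyticRankOverNumberField
import Literature.NumberTheory.EllipticCurves.AnalyticRankModularityProofs
import Literature.NumberTheory.EllipticCurves.AnalyticRankLSeriesSummableProofs
import Literature.NumberTheory.EllipticCurves.ModularSymbolsHeckeProofs
import Literature.NumberTheory.GaloisRepresentations.ArtinLemma
import HarnessLib

/-!
# `L(E/F, s)` is entire for `F ⊆ ℚ(ζ_m)` abelian: reduction to modularity at the semistable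
# places (towards `hasEntireLFunction_baseChange_fixedField`)

`Proofs` file (theorems only), sibling of
`Literature.NumberTheory.EllipticCurves.AnalyticRankOverNumberField`, whose named fact
`hasEntireLFunction_baseChange_fixedField` (for every elliptic `E/ℚ`, `m ≥ 1` and
`H ≤ Gal(ℚ(ζ_m)/ℚ)`, the Hasse–Weil `L`-series of `E` over `F = ℚ(ζ_m)^H` extends to an entire
function) is a theorem in print by the chain *modularity (BCDT 2001, Thm. A) + Artin formalism +
entire continuation of the twists `L(f ⊗ χ, s)`* (Rohrlich 1997, §3.9–3.10).  This file proves
that chain inside the tree as far as the tree's inputs reach: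

* `WeierstrassCurve.hasEntireLFunction_baseChange_of_exists_isNewformOf_of_forall` — assume the
  modularity theorem in its "Version `L`" form
  `Literature.NumberTheory.EllipticCurves.ModularForms.exists_isNewformOf` (the only unproved
  input; Diamond–Shurman Thm. 8.8.3, BCDT Thm. A).  Let `L ⊇ ℚ` be an `m`-th cyclotomic field,
  `F ⊆ L`, and `E/ℚ` elliptic such that **at every place `v` where `E` is not semistable, `E_F`
  has additive reduction at all `w ∣ v`** (automatic when `E` is semistable, and when the additive
  places of `E` are unramified in `F`).  Then `L(E_F, s)` is entire:
  by `WeierstrassCurve.intCoe_LFunction_baseChange_eq_prod_primitiveTwist_of_forall` (Artin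
  formalism with the true Euler factors at all semistable places, ramified or not)
  `L(E_F, s) = ∏_{χ ∈ X(F)} ∑ χ⋆(n) aₙ(E) n^{-s}` on `Re s > 3/2`, where `aₙ(E) = aₙ(f)` for the
  newform `f` of `E`, and each `L(f ⊗ χ⋆, s)` has an entire continuation
  (`exists_differentiable_eq_twistedLSeries_holds`, Shimura Thm. 3.66, agreeing with the series on
  `Re s > 2`, hence on `Re s > 3/2` by the identity theorem and the absolute convergence of
  `∑ aₙ(E) n^{-s}` there, `WeierstrassCurve.LSeriesSummable_of_lt_re_holds`).
* `WeierstrassCurve.hasEntireLFunction_baseChange_fixedField_of_exists_isNewformOf_of_isSemistable`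
  — the case of the named fact for **semistable** `E/ℚ` (and any `m`, `H`), modulo
  `exists_isNewformOf`; and `…_of_forall`, the same with the place-by-place hypothesis above.
* `WeierstrassCurve.hasEntireLFunction_baseChange_fixedField_of_exists_isNewformOf_of_forall_mem_isSemistableAt`
  — the case of the named fact for `E/ℚ` **semistable at the primes dividing `m`** (e.g.
  `(m, N_E) = 1`), modulo `exists_isNewformOf`: a place `v ∤ m` is unramified in `F ⊆ ℚ(ζ_m)`
  (`Literature.NumberTheory.EllipticCurves.ramificationIdxIn_eq_one_of_natCast_not_mem`, from the
  tree's `ArtinLemma.isUnramifiedAt_of_isCyclotomicExtension`), and additive reduction persists in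
  unramified extensions (`WeierstrassCurve.hasAdditiveReductionAt_baseChange_of_natCast_not_mem`,
  Silverman *AEC* VII.5.4, here through `L_w(E_F, T) = 1` and
  `WeierstrassCurve.hasAdditiveReductionAt_of_localPolynomialAt_eq_one`); `…_of_forall_mem` is the
  version with the place-by-place hypothesis required only at the places `v ∣ m`.

What separates this from `hasEntireLFunction_baseChange_fixedField` itself is (i) modularity and
(ii) the places `v ∣ m` of additive reduction of `E` above which `E_F` becomes semistable: there
the naive twisted series `∑ χ⋆(n) aₙ n^{-s}` has the wrong Euler factor and the missing input is
the local–global compatibility for `f ⊗ χ⋆` (Carayol 1986; Rohrlich 1997, §3.9), which the tree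
does not have.

## References

* D. E. Rohrlich, *Modular curves, Hecke correspondences, and L-functions*, in: Modular Forms
  and Fermat's Last Theorem (1997), §3.9–3.10. [Rohrlich1997]
* C. Breuil, B. Conrad, F. Diamond, R. Taylor, JAMS 14 (2001), Thm. A. [BCDTJAMS2001]
* F. Diamond, J. Shurman, *A First Course in Modular Forms* (2005), Thm. 8.8.3, Thm. 5.10.2.
  [DiamondShurman2005]
* G. Shimura, *Introduction to the Arithmetic Theory of Automorphic Functions* (1971), Thm. 3.66.
  [Shimura1971]
* K. Ireland, M. Rosen, *A Classical Introduction to Modern Number Theory*, 2nd ed. (1990),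
  Prop. 20.5.4. [IrelandRosen1990]
* J. H. Silverman, *The Arithmetic of Elliptic Curves*, 2nd ed. (2009), VII.5.4 and §C.16.
  [SilvermanAEC2009]
* L. C. Washington, *Introduction to Cyclotomic Fields*, 2nd ed. (1997), Prop. 2.3.
-/

noncomputable section

open scoped Classical NumberField
open Filter Topology ArithmeticFunction IsDedekindDomain NumberField
  Literature.NumberTheory.EllipticCurves Literature.NumberTheory.EllipticCurves.ModularForms
  IsCyclotomicExtension.Rat

namespace WeierstrassCurve

/-! ## `L`-series of finite products -/

/-- `L`-series of a finite product of arithmetic functions with summable `L`-series: summable,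
and equal to the product of the `L`-series (Mathlib `ArithmeticFunction.LSeries_mul'`, iterated).
[folklore] -/
private theorem LSeriesSummable_and_LSeries_finset_prod {α : Type*} (s : Finset α)
    (f : α → ArithmeticFunction ℂ) (z : ℂ) (hf : ∀ a ∈ s, LSeriesSummable (⇑(f a)) z) :
    LSeriesSummable (⇑(∏ a ∈ s, f a)) z ∧
      LSeries (⇑(∏ a ∈ s, f a)) z = ∏ a ∈ s, LSeries (⇑(f a)) z := by
  induction s using Finset.induction_on with
  | empty =>
    simp only [Finset.prod_empty]
    have h1 : (⇑(1 : ArithmeticFunction ℂ) : ℕ → ℂ) = LSeries.delta :=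
      ArithmeticFunction.one_eq_delta
    rw [h1, LSeries_delta, Pi.one_apply]
    refine ⟨summable_of_ne_finset_zero (s := {1}) fun n hn ↦ ?_, rfl⟩
    rw [Finset.mem_singleton] at hn
    rw [LSeries.term_delta, if_neg hn]
  | insert a s ha ih =>
    have hfa := hf a (Finset.mem_insert_self a s)
    obtain ⟨hs1, hs2⟩ := ih fun b hb ↦ hf b (Finset.mem_insert_of_mem hb)
    rw [Finset.prod_insert ha, Finset.prod_insert ha]
    exact ⟨ArithmeticFunction.LSeriesSummable_mul hfa hs1,
      by rw [ArithmeticFunction.LSeries_mul' hfa hs1, hs2]⟩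

/-! ## The twisted `L`-series `∑ χ⋆(n) aₙ(E) n^{-s}` are entire, given modularity -/

section Twist

variable (W : WeierstrassCurve ℚ)

/-- **`L(E ⊗ χ⋆, s)` is entire, modulo modularity.**  If `aₙ(E) = aₙ(f)` for a weight-`2` cusp
form `f ∈ S₂(Γ₀(N))`, then for every Dirichlet character `χ` the naive twist
`∑ χ⋆(n) aₙ(E) n^{-s}` by the primitive character `χ⋆` inducing `χ` is the restriction to
`Re s > 3/2` of an entire function: `L(f ⊗ χ⋆, s)` has an entire continuation agreeing with the
series on `Re s > 2` (`exists_differentiable_eq_twistedLSeries_holds`, Shimura Thm. 3.66), and the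
series converges absolutely, hence is holomorphic, on `Re s > 3/2`
(`LSeriesSummable_of_lt_re_holds`), so the two agree there (identity theorem).
[cite: Shimura1971, Thm. 3.66] -/
theorem exists_differentiable_eq_LSeries_primitiveTwist_of_cuspCoeff_eq {N : ℕ} [NeZero N]
    (f : CuspForm (CongruenceSubgroup.Gamma0 N) 2)
    (hf : ∀ n : ℕ, cuspCoeff f n = (W.LFunction n : ℂ)) {m : ℕ} [NeZero m]
    (χ : DirichletCharacter ℂ m) :
    ∃ Lχ : ℂ → ℂ, Differentiable ℂ Lχ ∧ ∀ s : ℂ, (3 / 2 : ℝ) < s.re →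
      Lχ s = LSeries (fun n ↦ χ.primitiveCharacter (n : ZMod χ.conductor) *
        ((W.LFunction n : ℤ) : ℂ)) s := by
  haveI : NeZero χ.conductor := ⟨χ.conductor_ne_zero⟩
  obtain ⟨Lχ, hLχ, hLeq⟩ := exists_differentiable_eq_twistedLSeries_holds f χ.primitiveCharacter
  set a : ℕ → ℂ := fun n ↦ χ.primitiveCharacter (n : ZMod χ.conductor) *
    ((W.LFunction n : ℤ) : ℂ) with ha
  -- absolute convergence of the twisted series on `Re s > 3/2`
  have hsum : ∀ s : ℂ, (3 / 2 : ℝ) < s.re → LSeriesSummable a s := fun s hs ↦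
    DirichletCharacter.LSeriesSummable_mul _ (W.LSeriesSummable_of_lt_re_holds hs)
  have habs : LSeries.abscissaOfAbsConv a ≤ (3 / 2 : ℝ) :=
    LSeries.abscissaOfAbsConv_le_of_forall_lt_LSeriesSummable fun y hy ↦
      hsum y (by simpa using hy)
  refine ⟨Lχ, hLχ, fun s hs ↦ ?_⟩
  -- the identity theorem on the half-plane `Re s > 3/2`
  have hU : IsOpen {z : ℂ | (3 / 2 : ℝ) < z.re} := isOpen_lt continuous_const Complex.continuous_re
  have hconn : IsPreconnected {z : ℂ | (3 / 2 : ℝ) < z.re} :=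
    (convex_halfSpace_re_gt (3 / 2 : ℝ)).isPreconnected
  have hg : AnalyticOnNhd ℂ (LSeries a) {z : ℂ | (3 / 2 : ℝ) < z.re} := by
    refine DifferentiableOn.analyticOnNhd (fun z hz ↦ ?_) hU
    have hz' : z ∈ {z : ℂ | LSeries.abscissaOfAbsConv a < z.re} :=
      lt_of_le_of_lt habs (by exact_mod_cast hz)
    exact ((LSeries_differentiableOn a).differentiableAt
      ((Complex.isOpen_re_gt_EReal _).mem_nhds hz')).differentiableWithinAt
  have hL : AnalyticOnNhd ℂ Lχ {z : ℂ | (3 / 2 : ℝ) < z.re} :=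
    hLχ.differentiableOn.analyticOnNhd hU
  have h3 : (3 : ℂ) ∈ {z : ℂ | (3 / 2 : ℝ) < z.re} := by
    simp only [Set.mem_setOf_eq]
    norm_num
  have hev : Lχ =ᶠ[𝓝 (3 : ℂ)] LSeries a := by
    have hopen2 : IsOpen {z : ℂ | (2 : ℝ) < z.re} := isOpen_lt continuous_const Complex.continuous_re
    have hmem2 : (3 : ℂ) ∈ {z : ℂ | (2 : ℝ) < z.re} := by
      simp only [Set.mem_setOf_eq]
      norm_num
    filter_upwards [hopen2.mem_nhds hmem2] with z hz
    rw [hLeq z (by exact_mod_cast hz), twistedLSeries]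
    exact LSeries_congr (fun {n} _ ↦ by rw [hf n]) z
  exact hL.eqOn_of_preconnected_of_eventuallyEq hg hconn h3 hev hs

end Twist

/-! ## `L(E_F, s)` is entire, modulo modularity, when `E_F` stays additive above the
non-semistable places of `E` -/

section Assembly

variable (W : WeierstrassCurve ℚ) [W.IsElliptic] (m : ℕ) [NeZero m] (L : Type) [Field L]
  [NumberField L] [hL : IsCyclotomicExtension {m} ℚ L] (F : IntermediateField ℚ L)

include hL in
/-- **`L(E/F, s)` is entire for `F ⊆ ℚ(ζ_m)`, modulo modularity, at the semistable level.**
Assume the modularity theorem `exists_isNewformOf` (Diamond–Shurman Thm. 8.8.3; BCDT 2001,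
Thm. A).  Let `L ⊇ ℚ` be an `m`-th cyclotomic field, `F ⊆ L` an intermediate field and `E/ℚ` an
elliptic curve such that `E_F` has additive reduction at every place above a place where `E` is
not semistable.  Then the Hasse–Weil `L`-series of `E_F` extends to an entire function
(`(W.baseChange F).HasEntireLFunction`): by the Artin formalism
`L(E_F, s) = ∏_{χ ∈ X(F)} ∑ χ⋆(n) aₙ(E) n^{-s}` on `Re s > 3/2`
(`intCoe_LFunction_baseChange_eq_prod_primitiveTwist_of_forall`; the `L`-series of a finite
Dirichlet product is the product of the `L`-series), and each factor is the restriction of an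
entire function (`exists_differentiable_eq_LSeries_primitiveTwist_of_cuspCoeff_eq`, twists of the
newform of `E`).  This is the printed proof of the entire continuation of `L(E/F, s)` for abelian
`F` (Rohrlich 1997, §3.9–3.10: modularity, Artin formalism, Shimura/Carayol for the twists) at
the places where its local Euler factors are the naive ones.
[cite: Rohrlich1997, §3.9–3.10] [cite: DiamondShurman2005, Thm. 8.8.3] -/
theorem hasEntireLFunction_baseChange_of_exists_isNewformOf_of_forall
    (hX : exists_isNewformOf)
    (hadd : ∀ v : HeightOneSpectrum (𝓞 ℚ), ¬ W.IsSemistableAt v →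
      ∀ w : HeightOneSpectrum (𝓞 F), w.asIdeal.under (𝓞 ℚ) = v.asIdeal →
        (W.baseChange F).HasAdditiveReductionAt w) :
    (W.baseChange F).HasEntireLFunction := by
  haveI : NeZero (W.conductorNorm ℤ) := ⟨(W.conductorNorm_pos_holds).ne'⟩
  obtain ⟨f, hf⟩ := hX W
  choose Lχ hLχd hLχeq using
    fun χ : DirichletCharacter ℂ m ↦
      W.exists_differentiable_eq_LSeries_primitiveTwist_of_cuspCoeff_eq f hf.2 χ
  refine ⟨fun s ↦ ∏ χ ∈ ({χ | ∀ σ ∈ F.fixingSubgroup, χ (galEquivZMod m L σ) = 1} :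
      Finset (DirichletCharacter ℂ m)), Lχ χ s, ?_, fun s hs ↦ ?_⟩
  · exact fun s ↦ DifferentiableAt.fun_finsetProd fun χ _ ↦ hLχd χ s
  · -- the `L`-series of the twists
    have htw : ∀ χ : DirichletCharacter ℂ m,
        (⇑((toArithmeticFunction fun k : ℕ ↦ χ.primitiveCharacter (k : ZMod χ.conductor)).pmul
          ((W.LFunction : ArithmeticFunction ℤ) : ArithmeticFunction ℂ)) : ℕ → ℂ) =
          fun n : ℕ ↦ χ.primitiveCharacter (n : ZMod χ.conductor) * ((W.LFunction n : ℤ) : ℂ) := by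
      intro χ
      funext n
      rw [toArithmeticFunction_pmul_apply, intCoe_apply]
    have htws : ∀ χ : DirichletCharacter ℂ m, LSeriesSummable
        (⇑((toArithmeticFunction fun k : ℕ ↦ χ.primitiveCharacter (k : ZMod χ.conductor)).pmul
          ((W.LFunction : ArithmeticFunction ℤ) : ArithmeticFunction ℂ))) s := by
      intro χ
      rw [htw]
      exact DirichletCharacter.LSeriesSummable_mul _ (W.LSeriesSummable_of_lt_re_holds hs)
    -- Artin formalism, as an identity of `L`-series
    have hid := W.intCoe_LFunction_baseChange_eq_prod_primitiveTwist_of_forall (m := m) L F hadd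
    have hcoe : ((↑) ∘ (W.baseChange F).LFunction : ℕ → ℂ) =
        ⇑(((W.baseChange F).LFunction : ArithmeticFunction ℤ) : ArithmeticFunction ℂ) := by
      funext n
      rw [Function.comp_apply, intCoe_apply]
    simp only
    rw [Finset.prod_congr rfl fun χ _ ↦ hLχeq χ s hs, WeierstrassCurve.LSeries, hcoe, hid,
      (LSeriesSummable_and_LSeries_finset_prod _ _ s fun χ _ ↦ htws χ).2]
    exact Finset.prod_congr rfl fun χ _ ↦ by rw [htw]

include hL in
/-- **`L(E/F, s)` is entire for semistable `E/ℚ` and `F ⊆ ℚ(ζ_m)`, modulo modularity**: the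
case `E` semistable of `hasEntireLFunction_baseChange_of_exists_isNewformOf_of_forall` (no place
of additive reduction, so no hypothesis above them). [cite: Rohrlich1997, §3.9–3.10] -/
theorem hasEntireLFunction_baseChange_of_exists_isNewformOf_of_isSemistable
    (hX : exists_isNewformOf) (hss : W.IsSemistable (𝓞 ℚ)) :
    (W.baseChange F).HasEntireLFunction :=
  W.hasEntireLFunction_baseChange_of_exists_isNewformOf_of_forall m L F hX
    fun v hv ↦ absurd (hss v) hv

end Assembly

/-! ## The shape of `hasEntireLFunction_baseChange_fixedField` -/

section FixedField

variable (W : WeierstrassCurve ℚ) [W.IsElliptic] (m : ℕ) [NeZero m]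
  (H : Subgroup (CyclotomicField m ℚ ≃ₐ[ℚ] CyclotomicField m ℚ))

/-- **Towards `hasEntireLFunction_baseChange_fixedField`: the place-by-place reduction to
modularity.**  For `E/ℚ` elliptic, `m ≥ 1`, `H ≤ Gal(ℚ(ζ_m)/ℚ)` and `F = ℚ(ζ_m)^H`, if `E_F` has
additive reduction above every place where `E` is not semistable, then `L(E/F, s)` is entire —
assuming `exists_isNewformOf`.  (The named fact itself, for all `E`, additionally needs the
local–global compatibility of `f ⊗ χ⋆` at the primes of additive reduction of `E` above which
`E_F` becomes semistable: Carayol 1986, Rohrlich 1997 §3.9.) [cite: Rohrlich1997, §3.9–3.10] -/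
theorem hasEntireLFunction_baseChange_fixedField_of_exists_isNewformOf_of_forall
    (hX : exists_isNewformOf)
    (hadd : ∀ v : HeightOneSpectrum (𝓞 ℚ), ¬ W.IsSemistableAt v →
      ∀ w : HeightOneSpectrum (𝓞 ↥(IntermediateField.fixedField H)),
        w.asIdeal.under (𝓞 ℚ) = v.asIdeal →
          (W.baseChange ↥(IntermediateField.fixedField H)).HasAdditiveReductionAt w) :
    (W.baseChange ↥(IntermediateField.fixedField H)).HasEntireLFunction :=
  haveI : IsCyclotomicExtension {m} ℚ (CyclotomicField m ℚ) :=
    CyclotomicField.isCyclotomicExtension m ℚ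
  W.hasEntireLFunction_baseChange_of_exists_isNewformOf_of_forall m (CyclotomicField m ℚ)
    (IntermediateField.fixedField H) hX hadd

/-- **`hasEntireLFunction_baseChange_fixedField` for semistable curves, modulo modularity**: for
`E/ℚ` semistable, every `m ≥ 1` and `H ≤ Gal(ℚ(ζ_m)/ℚ)`, `L(E/ℚ(ζ_m)^H, s)` is entire, assuming
`exists_isNewformOf` (Rohrlich 1997, §3.9–3.10 with Wiles–Taylor–Wiles/BCDT and Shimura
Thm. 3.66; here through the Artin formalism with the true Euler factors at all, possibly ramified,
semistable places). [cite: Rohrlich1997, §3.9–3.10] -/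
theorem hasEntireLFunction_baseChange_fixedField_of_exists_isNewformOf_of_isSemistable
    (hX : exists_isNewformOf) (hss : W.IsSemistable (𝓞 ℚ)) :
    (W.baseChange ↥(IntermediateField.fixedField H)).HasEntireLFunction :=
  W.hasEntireLFunction_baseChange_fixedField_of_exists_isNewformOf_of_forall m H hX
    fun v hv ↦ absurd (hss v) hv

end FixedField

/-! ## Away from `m`: additive reduction persists, so only the places dividing `m` matter -/

section AwayFromLevel

open Polynomial Literature.NumberTheory.GaloisRepresentations

/-- **Additive reduction is read off the local polynomial**: Mathlib's local polynomial
`L_v(E, T)` is `1 - a_v T + q_v T²` at good reduction (`q_v = #k_v ≥ 2`), `1 ∓ T` at multiplicative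
reduction and `1` at additive reduction (Silverman *AEC* §C.16), so `L_v(E, T) = 1` forces additive
reduction (trichotomy `hasGoodReductionAt_or_hasMultiplicativeReductionAt_or_hasAdditiveReductionAt`).
[cite: SilvermanAEC2009, §C.16 (PDF p. 390)] -/
theorem hasAdditiveReductionAt_of_localPolynomialAt_eq_one {K : Type*} [Field K] [NumberField K]
    (V : WeierstrassCurve K) {v : HeightOneSpectrum (𝓞 K)} (h : V.localPolynomialAt v = 1) :
    V.HasAdditiveReductionAt v := by
  rcases V.hasGoodReductionAt_or_hasMultiplicativeReductionAt_or_hasAdditiveReductionAt v with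
    hg | hm | ha
  · exfalso
    have h2 := congrArg (fun P : ℤ[X] ↦ P.coeff 2) h
    simp only [localPolynomialAt_of_hasGoodReductionAt hg, coeff_add, coeff_sub, coeff_one,
      coeff_C_mul, coeff_X, coeff_X_pow] at h2
    norm_num at h2
    have hq := IsDedekindDomain.HeightOneSpectrum.one_lt_residueCard v
    rw [← natCard_residueField_eq_residueCard v] at hq
    omega
  · exfalso
    by_cases hs : V.HasSplitMultiplicativeReductionAt v
    · have h1 := congrArg (fun P : ℤ[X] ↦ P.coeff 1) h
      simp only [localPolynomialAt_of_hasSplitMultiplicativeReductionAt hs, coeff_sub, coeff_one,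
        coeff_X] at h1
      norm_num at h1
    · have h1 := congrArg (fun P : ℤ[X] ↦ P.coeff 1) h
      simp only [localPolynomialAt_of_hasMultiplicativeReductionAt_of_not_hasSplitMultiplicativeReductionAt
        hm hs, coeff_add, coeff_one, coeff_X] at h1
      norm_num at h1
  · exact ha

variable {m : ℕ} [NeZero m] (L : Type) [Field L] [NumberField L]
  [hL : IsCyclotomicExtension {m} ℚ L] (F : IntermediateField ℚ L)

include hL in
/-- **A place of `ℚ` away from `m` is unramified in every subfield of an `m`-th cyclotomic
field**: `e_v(F/ℚ) = 1` for `F ⊆ L = ℚ(ζ_m)` and `m ∉ v` (`m` lies in the different of `L/ℚ`,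
the tree's `ArtinLemma.isUnramifiedAt_of_isCyclotomicExtension`; unramifiedness descends to
intermediate fields, `ArtinLemma.isUnramifiedIn_intermediateField`).  Washington, *Introduction to
Cyclotomic Fields*, Prop. 2.3. [folklore] -/
theorem _root_.Literature.NumberTheory.EllipticCurves.ramificationIdxIn_eq_one_of_natCast_not_mem
    {v : HeightOneSpectrum (𝓞 ℚ)} (hv : (m : 𝓞 ℚ) ∉ v.asIdeal) :
    v.asIdeal.ramificationIdxIn (𝓞 F) = 1 := by
  haveI : IsAbelianGalois ℚ L := IsCyclotomicExtension.isAbelianGalois {m} ℚ L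
  haveI : IsGalois ℚ F := (IsAbelianGalois.tower_bot ℚ F L).toIsGalois
  have hunrL : Algebra.IsUnramifiedIn (𝓞 L) v.asIdeal := by
    intro Q hQ hover
    haveI := hQ
    refine ArtinLemma.isUnramifiedAt_of_isCyclotomicExtension (L := ℚ) (m := m) Q fun h ↦ hv ?_
    rw [hover.over, Ideal.under_def, Ideal.mem_comap, map_natCast]
    exact h
  exact ramificationIdxIn_eq_one_of_isUnramifiedIn
    (ArtinLemma.isUnramifiedIn_intermediateField (F := ℚ) (M := L) F hunrL)

variable (W : WeierstrassCurve ℚ) [W.IsElliptic]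

include hL in
/-- **Away from `m`, additive reduction of `E` persists in `E_F`** (Silverman *AEC* VII.5.4 with
V.2.3.1/§C.16: the reduction type is unchanged in an unramified extension).  For `F ⊆ ℚ(ζ_m)`, a
place `v ∌ m` of `ℚ` where `E` is not semistable and `w ∣ v`: `v` is unramified in `F`
(`ramificationIdxIn_eq_one_of_natCast_not_mem`), so `L_w(E_F, T)` is computed from
`L_v(E, T) = 1` by `localPolynomialAt_baseChange_of_ramificationIdxIn_eq_one`, giving
`L_w(E_F, T) = 1`. [cite: SilvermanAEC2009, VII.5.4 and §C.16 (PDF p. 390)] -/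
theorem localPolynomialAt_baseChange_eq_one_of_natCast_not_mem
    {v : HeightOneSpectrum (𝓞 ℚ)} {w : HeightOneSpectrum (𝓞 F)}
    (hw : w.asIdeal.under (𝓞 ℚ) = v.asIdeal) (hv : ¬ W.IsSemistableAt v)
    (hmv : (m : 𝓞 ℚ) ∉ v.asIdeal) :
    (W.baseChange F).localPolynomialAt w = 1 := by
  haveI : IsAbelianGalois ℚ L := IsCyclotomicExtension.isAbelianGalois {m} ℚ L
  haveI : IsGalois ℚ F := (IsAbelianGalois.tower_bot ℚ F L).toIsGalois
  have hadd : W.HasAdditiveReductionAt v := by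
    by_contra h
    exact hv ((W.isSemistableAt_iff_not_hasAdditiveReductionAt v).mpr h)
  have hvL : W.localPolynomialAt v = 1 - C (0 : ℤ) * X + C (0 : ℤ) * X ^ 2 := by
    rw [localPolynomialAt_of_hasAdditiveReductionAt hadd]
    simp
  have he := Literature.NumberTheory.EllipticCurves.ramificationIdxIn_eq_one_of_natCast_not_mem
    L F hmv
  have hf : 0 < w.asIdeal.inertiaDeg (𝓞 ℚ) := by
    haveI : w.asIdeal.IsMaximal := w.isMaximal
    haveI : w.asIdeal.LiesOver v.asIdeal := ⟨hw.symm⟩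
    exact Ideal.inertiaDeg_pos w.asIdeal (𝓞 ℚ)
  rw [W.localPolynomialAt_baseChange_of_ramificationIdxIn_eq_one (↥F) hw he hvL,
    zero_pow hf.ne']
  -- `D_f(0, 0) = 0`: `α^f + β^f` with `α = β = 0`
  have hD : ∀ n : ℕ, 0 < n → (dickson 1 (0 : ℤ) n).eval 0 = 0 := by
    intro n hn
    match n, hn with
    | 1, _ => simp [dickson_one]
    | n + 2, _ => simp [dickson_add_two]
  rw [hD _ hf]
  simp

include hL in
/-- **Additive reduction of `E` away from `m` stays additive over `F ⊆ ℚ(ζ_m)`**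
(Silverman *AEC* VII.5.4: reduction type is unchanged in unramified extensions), for Mathlib's
reduction types, through `L_w(E_F, T) = 1`. [cite: SilvermanAEC2009, VII.5.4 and §C.16 (PDF p. 390)] -/
theorem hasAdditiveReductionAt_baseChange_of_natCast_not_mem
    {v : HeightOneSpectrum (𝓞 ℚ)} {w : HeightOneSpectrum (𝓞 F)}
    (hw : w.asIdeal.under (𝓞 ℚ) = v.asIdeal) (hv : ¬ W.IsSemistableAt v)
    (hmv : (m : 𝓞 ℚ) ∉ v.asIdeal) :
    (W.baseChange F).HasAdditiveReductionAt w :=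
  (W.baseChange F).hasAdditiveReductionAt_of_localPolynomialAt_eq_one
    (W.localPolynomialAt_baseChange_eq_one_of_natCast_not_mem L F hw hv hmv)

include hL in
/-- **`L(E/F, s)` is entire for `F ⊆ ℚ(ζ_m)`, modulo modularity, when `E_F` stays additive above
the additive places of `E` dividing `m`.**  As
`hasEntireLFunction_baseChange_of_exists_isNewformOf_of_forall`, but the place-by-place
hypothesis is only needed at the places `v ∣ m`: away from `m` the extension `F/ℚ` is unramified
and additive reduction persists (`hasAdditiveReductionAt_baseChange_of_natCast_not_mem`).
[cite: Rohrlich1997, §3.9–3.10] [cite: DiamondShurman2005, Thm. 8.8.3] -/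
theorem hasEntireLFunction_baseChange_of_exists_isNewformOf_of_forall_mem
    (hX : exists_isNewformOf)
    (hadd : ∀ v : HeightOneSpectrum (𝓞 ℚ), ¬ W.IsSemistableAt v → (m : 𝓞 ℚ) ∈ v.asIdeal →
      ∀ w : HeightOneSpectrum (𝓞 F), w.asIdeal.under (𝓞 ℚ) = v.asIdeal →
        (W.baseChange F).HasAdditiveReductionAt w) :
    (W.baseChange F).HasEntireLFunction :=
  W.hasEntireLFunction_baseChange_of_exists_isNewformOf_of_forall m L F hX fun v hv w hw ↦
    if hmv : (m : 𝓞 ℚ) ∈ v.asIdeal then hadd v hv hmv w hw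
    else W.hasAdditiveReductionAt_baseChange_of_natCast_not_mem L F hw hv hmv

include hL in
/-- **`L(E/F, s)` is entire for `F ⊆ ℚ(ζ_m)` when `E` is semistable at the primes dividing `m`,
modulo modularity** (e.g. `(m, N_E) = 1`, or `N_E` squarefree at the primes of `m`): then `E` has
no additive place dividing `m`, and at its additive places away from `m` the reduction of `E_F`
is again additive, so the Artin formalism holds with the naive twisted Euler factors everywhere
(Rohrlich 1997, §3.9–3.10, modularity + Shimura Thm. 3.66 for the twists).
[cite: Rohrlich1997, §3.9–3.10] [cite: DiamondShurman2005, Thm. 8.8.3] -/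
theorem hasEntireLFunction_baseChange_of_exists_isNewformOf_of_forall_mem_isSemistableAt
    (hX : exists_isNewformOf)
    (hm : ∀ v : HeightOneSpectrum (𝓞 ℚ), (m : 𝓞 ℚ) ∈ v.asIdeal → W.IsSemistableAt v) :
    (W.baseChange F).HasEntireLFunction :=
  W.hasEntireLFunction_baseChange_of_exists_isNewformOf_of_forall_mem L F hX
    fun v hv hmv ↦ absurd (hm v hmv) hv

end AwayFromLevel

section FixedFieldAwayFromLevel

variable (W : WeierstrassCurve ℚ) [W.IsElliptic] (m : ℕ) [NeZero m]
  (H : Subgroup (CyclotomicField m ℚ ≃ₐ[ℚ] CyclotomicField m ℚ))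

/-- **Towards `hasEntireLFunction_baseChange_fixedField`, the places dividing `m`.**  For `E/ℚ`
elliptic, `m ≥ 1`, `H ≤ Gal(ℚ(ζ_m)/ℚ)` and `F = ℚ(ζ_m)^H`: if `E_F` has additive reduction above
every place `v ∣ m` at which `E` is not semistable, then `L(E/F, s)` is entire — assuming
`exists_isNewformOf`.  What the named fact still needs beyond modularity is thus confined to the
places `v ∣ m` of additive reduction of `E` above which `E_F` turns semistable (local–global
compatibility for `f ⊗ χ⋆` there: Carayol 1986; Rohrlich 1997, §3.9).
[cite: Rohrlich1997, §3.9–3.10] -/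
theorem hasEntireLFunction_baseChange_fixedField_of_exists_isNewformOf_of_forall_mem
    (hX : exists_isNewformOf)
    (hadd : ∀ v : HeightOneSpectrum (𝓞 ℚ), ¬ W.IsSemistableAt v → (m : 𝓞 ℚ) ∈ v.asIdeal →
      ∀ w : HeightOneSpectrum (𝓞 ↥(IntermediateField.fixedField H)),
        w.asIdeal.under (𝓞 ℚ) = v.asIdeal →
          (W.baseChange ↥(IntermediateField.fixedField H)).HasAdditiveReductionAt w) :
    (W.baseChange ↥(IntermediateField.fixedField H)).HasEntireLFunction :=
  haveI : IsCyclotomicExtension {m} ℚ (CyclotomicField m ℚ) :=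
    CyclotomicField.isCyclotomicExtension m ℚ
  W.hasEntireLFunction_baseChange_of_exists_isNewformOf_of_forall_mem (CyclotomicField m ℚ)
    (IntermediateField.fixedField H) hX hadd

/-- **`hasEntireLFunction_baseChange_fixedField` for curves semistable at the primes of `m`,
modulo modularity**: for `E/ℚ` with good or multiplicative reduction at every prime dividing `m`
(in particular whenever `(m, N_E) = 1`), every `H ≤ Gal(ℚ(ζ_m)/ℚ)` has `L(E/ℚ(ζ_m)^H, s)` entire,
assuming `exists_isNewformOf` (Rohrlich 1997, §3.9–3.10 with BCDT Thm. A and Shimura Thm. 3.66;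
the additive places of `E` are then unramified in `ℚ(ζ_m)^H`). [cite: Rohrlich1997, §3.9–3.10] -/
theorem hasEntireLFunction_baseChange_fixedField_of_exists_isNewformOf_of_forall_mem_isSemistableAt
    (hX : exists_isNewformOf)
    (hm : ∀ v : HeightOneSpectrum (𝓞 ℚ), (m : 𝓞 ℚ) ∈ v.asIdeal → W.IsSemistableAt v) :
    (W.baseChange ↥(IntermediateField.fixedField H)).HasEntireLFunction :=
  W.hasEntireLFunction_baseChange_fixedField_of_exists_isNewformOf_of_forall_mem m H hX
    fun v hv hmv ↦ absurd (hm v hmv) hv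

end FixedFieldAwayFromLevel

end WeierstrassCurve

end
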